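import Mathlib

/-!
# PercRepro — C-025 at `(6,4)`: the structure `S₀` of §21.18.9.3, the COUNTING half — at most `50` sets `Z ⊆ ρ ∪ L`
with `Z` and its complement inside listed sets (p2, gen 8; Mathlib only).  Pure finset combinatorics: `ρ` has `5` points with a distinguished `z ∈ ρ` (`μ = ρ ∖ {z}` the
`4`-line), `L` has `3` points disjoint from `ρ`; the listed sets are `ρ`, `L ∪ {z, y}` (`y ∈ μ`) and `{x} ∪ μ` (`x ∈ L`).
-/

namespace PercRepro.SixFour.S0

variable {α : Type*} [DecidableEq α]

/-- The eight listed sets. -/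
def Listed (ρ L : Finset α) (z : α) (T : Finset α) : Prop :=
  T = ρ ∨ (∃ y ∈ ρ.erase z, T = insert y (insert z L)) ∨ (∃ x ∈ L, T = insert x (ρ.erase z))

/-- The `50` candidate sets. -/
def Fam (ρ L : Finset α) (z : α) : Finset (Finset α) :=
  {L, insert z L, ρ.erase z, ρ} ∪ (ρ.erase z).image (fun y => insert y L) ∪
    (ρ.erase z).image (fun y => insert y (insert z L)) ∪ (ρ.erase z).image (fun y => (ρ.erase z).erase y) ∪
    (ρ.erase z).image (fun y => insert z ((ρ.erase z).erase y)) ∪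
    ((ρ.erase z) ×ˢ L).image (fun yx => insert yx.2 ((ρ.erase z).erase yx.1)) ∪
    L.image (fun x => insert x (ρ.erase z)) ∪ L.image (fun x => insert z (L.erase x)) ∪
    (L ×ˢ (ρ.erase z)).image (fun xy => insert xy.2 (insert z (L.erase xy.1)))

/-- `#Fam ≤ 50`. -/
theorem card_Fam_le (ρ L : Finset α) (z : α) (hρ : ρ.card = 5) (hz : z ∈ ρ) (hL : L.card = 3) :
    (Fam ρ L z).card ≤ 50 := by
  have hμ : (ρ.erase z).card = 4 := by rw [Finset.card_erase_of_mem hz, hρ]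
  unfold Fam
  refine (Finset.card_union_le _ _).trans ?_
  refine (add_le_add (Finset.card_union_le _ _) (Finset.card_image_le)).trans ?_
  refine (add_le_add (add_le_add (Finset.card_union_le _ _) Finset.card_image_le) le_rfl).trans ?_
  refine (add_le_add (add_le_add (add_le_add (Finset.card_union_le _ _) Finset.card_image_le) le_rfl) le_rfl).trans ?_
  refine (add_le_add (add_le_add (add_le_add (add_le_add (Finset.card_union_le _ _) Finset.card_image_le) le_rfl) le_rfl) le_rfl).trans ?_
  refine (add_le_add (add_le_add (add_le_add (add_le_add (add_le_add (Finset.card_union_le _ _) Finset.card_image_le) le_rfl) le_rfl) le_rfl) le_rfl).trans ?_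
  refine (add_le_add (add_le_add (add_le_add (add_le_add (add_le_add (add_le_add (Finset.card_union_le _ _) Finset.card_image_le) le_rfl) le_rfl) le_rfl) le_rfl) le_rfl).trans ?_
  refine (add_le_add (add_le_add (add_le_add (add_le_add (add_le_add (add_le_add (add_le_add (Finset.card_union_le _ _) Finset.card_image_le) le_rfl) le_rfl) le_rfl) le_rfl) le_rfl) le_rfl).trans ?_
  refine (add_le_add (add_le_add (add_le_add (add_le_add (add_le_add (add_le_add (add_le_add (add_le_add (Finset.card_le_four) Finset.card_image_le) le_rfl) le_rfl) le_rfl) le_rfl) le_rfl) le_rfl) le_rfl).trans ?_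
  simp only [Finset.card_product, hμ, hL]
  norm_num

/-! ## Membership in `Fam` -/

section Fam

variable {ρ L : Finset α} {z : α}

/-- The four base sets `L`, `L ∪ {z}`, `μ = ρ ∖ {z}`, `ρ` are in `Fam`. -/
theorem mem_Fam_base {T : Finset α} (h : T = L ∨ T = insert z L ∨ T = ρ.erase z ∨ T = ρ) : T ∈ Fam ρ L z := by
  unfold Fam
  refine Finset.mem_union_left _ (Finset.mem_union_left _ (Finset.mem_union_left _ (Finset.mem_union_left _
    (Finset.mem_union_left _ (Finset.mem_union_left _ (Finset.mem_union_left _ (Finset.mem_union_left _ ?_)))))))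
  simp only [Finset.mem_insert, Finset.mem_singleton]
  exact h

/-- `L ∪ {y} ∈ Fam` for `y ∈ μ`. -/
theorem mem_Fam_1 {y : α} (hy : y ∈ ρ.erase z) : insert y L ∈ Fam ρ L z := by
  unfold Fam
  refine Finset.mem_union_left _ (Finset.mem_union_left _ (Finset.mem_union_left _ (Finset.mem_union_left _
    (Finset.mem_union_left _ (Finset.mem_union_left _ (Finset.mem_union_left _ (Finset.mem_union_right _ ?_)))))))
  exact Finset.mem_image.2 ⟨y, hy, rfl⟩

/-- `L ∪ {z, y} ∈ Fam` for `y ∈ μ`. -/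
theorem mem_Fam_2 {y : α} (hy : y ∈ ρ.erase z) : insert y (insert z L) ∈ Fam ρ L z := by
  unfold Fam
  refine Finset.mem_union_left _ (Finset.mem_union_left _ (Finset.mem_union_left _ (Finset.mem_union_left _
    (Finset.mem_union_left _ (Finset.mem_union_left _ (Finset.mem_union_right _ ?_))))))
  exact Finset.mem_image.2 ⟨y, hy, rfl⟩

/-- `μ ∖ {y} ∈ Fam` for `y ∈ μ`. -/
theorem mem_Fam_3 {y : α} (hy : y ∈ ρ.erase z) : (ρ.erase z).erase y ∈ Fam ρ L z := by
  unfold Fam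
  refine Finset.mem_union_left _ (Finset.mem_union_left _ (Finset.mem_union_left _ (Finset.mem_union_left _
    (Finset.mem_union_left _ (Finset.mem_union_right _ ?_)))))
  exact Finset.mem_image.2 ⟨y, hy, rfl⟩

/-- `(μ ∖ {y}) ∪ {z} ∈ Fam` for `y ∈ μ`. -/
theorem mem_Fam_4 {y : α} (hy : y ∈ ρ.erase z) : insert z ((ρ.erase z).erase y) ∈ Fam ρ L z := by
  unfold Fam
  refine Finset.mem_union_left _ (Finset.mem_union_left _ (Finset.mem_union_left _ (Finset.mem_union_left _
    (Finset.mem_union_right _ ?_))))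
  exact Finset.mem_image.2 ⟨y, hy, rfl⟩

/-- `(μ ∖ {y}) ∪ {x} ∈ Fam` for `y ∈ μ`, `x ∈ L`. -/
theorem mem_Fam_5 {y x : α} (hy : y ∈ ρ.erase z) (hx : x ∈ L) : insert x ((ρ.erase z).erase y) ∈ Fam ρ L z := by
  unfold Fam
  refine Finset.mem_union_left _ (Finset.mem_union_left _ (Finset.mem_union_left _ (Finset.mem_union_right _ ?_)))
  exact Finset.mem_image.2 ⟨(y, x), Finset.mem_product.2 ⟨hy, hx⟩, rfl⟩

/-- `μ ∪ {x} ∈ Fam` for `x ∈ L`. -/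
theorem mem_Fam_6 {x : α} (hx : x ∈ L) : insert x (ρ.erase z) ∈ Fam ρ L z := by
  unfold Fam
  refine Finset.mem_union_left _ (Finset.mem_union_left _ (Finset.mem_union_right _ ?_))
  exact Finset.mem_image.2 ⟨x, hx, rfl⟩

/-- `(L ∖ {x}) ∪ {z} ∈ Fam` for `x ∈ L`. -/
theorem mem_Fam_7 {x : α} (hx : x ∈ L) : insert z (L.erase x) ∈ Fam ρ L z := by
  unfold Fam
  refine Finset.mem_union_left _ (Finset.mem_union_right _ ?_)
  exact Finset.mem_image.2 ⟨x, hx, rfl⟩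

/-- `(L ∖ {x}) ∪ {z, y} ∈ Fam` for `x ∈ L`, `y ∈ μ`. -/
theorem mem_Fam_8 {x y : α} (hx : x ∈ L) (hy : y ∈ ρ.erase z) : insert y (insert z (L.erase x)) ∈ Fam ρ L z := by
  unfold Fam
  refine Finset.mem_union_right _ ?_
  exact Finset.mem_image.2 ⟨(x, y), Finset.mem_product.2 ⟨hx, hy⟩, rfl⟩

/-! ## The feasible covering pairs -/

/-- A point of `ρ ∪ L` outside `T₂` is in `Z` when `(ρ ∪ L) ∖ Z ⊆ T₂`. -/
theorem mem_of_notMem {Z T : Finset α} (h : (ρ ∪ L) \ Z ⊆ T) {v : α} (hv : v ∈ ρ ∪ L) (hvT : v ∉ T) : v ∈ Z := by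
  by_contra hvZ
  exact hvT (h (Finset.mem_sdiff.2 ⟨hv, hvZ⟩))

/-- `(T₁, T₂) = (L ∪ {z, y}, ρ)`: `L ⊆ Z ⊆ L ∪ {z, y}`. -/
theorem combo_Ay_rho (hdisj : ∀ v ∈ L, v ∉ ρ) {y : α} (hy : y ∈ ρ.erase z) {Z : Finset α}
    (hZ1 : Z ⊆ insert y (insert z L)) (hZ2 : (ρ ∪ L) \ Z ⊆ ρ) : Z ∈ Fam ρ L z := by
  have hLZ : L ⊆ Z := fun v hv => mem_of_notMem hZ2 (Finset.mem_union_right _ hv) (hdisj v hv)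
  by_cases hyZ : y ∈ Z <;> by_cases hzZ : z ∈ Z
  · have hZeq : Z = insert y (insert z L) := Finset.Subset.antisymm hZ1 (by
      intro v hv
      rw [Finset.mem_insert, Finset.mem_insert] at hv
      rcases hv with rfl | rfl | hv
      · exact hyZ
      · exact hzZ
      · exact hLZ hv)
    rw [hZeq]
    exact mem_Fam_2 hy
  · have hZeq : Z = insert y L := by
      apply Finset.Subset.antisymm
      · intro v hv
        have := hZ1 hv
        rw [Finset.mem_insert, Finset.mem_insert] at this
        rw [Finset.mem_insert]
        rcases this with h | h | h
        · exact Or.inl h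
        · exact absurd (h ▸ hv) hzZ
        · exact Or.inr h
      · intro v hv
        rw [Finset.mem_insert] at hv
        rcases hv with rfl | hv
        · exact hyZ
        · exact hLZ hv
    rw [hZeq]
    exact mem_Fam_1 hy
  · have hZeq : Z = insert z L := by
      apply Finset.Subset.antisymm
      · intro v hv
        have := hZ1 hv
        rw [Finset.mem_insert, Finset.mem_insert] at this
        rw [Finset.mem_insert]
        rcases this with h | h | h
        · exact absurd (h ▸ hv) hyZ
        · exact Or.inl h
        · exact Or.inr h
      · intro v hv
        rw [Finset.mem_insert] at hv
        rcases hv with rfl | hv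
        · exact hzZ
        · exact hLZ hv
    rw [hZeq]
    exact mem_Fam_base (Or.inr (Or.inl rfl))
  · have hZeq : Z = L := by
      apply Finset.Subset.antisymm
      · intro v hv
        have := hZ1 hv
        rw [Finset.mem_insert, Finset.mem_insert] at this
        rcases this with h | h | h
        · exact absurd (h ▸ hv) hyZ
        · exact absurd (h ▸ hv) hzZ
        · exact h
      · exact hLZ
    rw [hZeq]
    exact mem_Fam_base (Or.inl rfl)

/-- `(T₁, T₂) = (ρ, L ∪ {z, y})`: `μ ∖ {y} ⊆ Z ⊆ ρ`. -/
theorem combo_rho_Ay (hdisj : ∀ v ∈ L, v ∉ ρ) {y : α} (hy : y ∈ ρ.erase z) {Z : Finset α}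
    (hZ1 : Z ⊆ ρ) (hZ2 : (ρ ∪ L) \ Z ⊆ insert y (insert z L)) : Z ∈ Fam ρ L z := by
  have hμZ : (ρ.erase z).erase y ⊆ Z := fun v hv => by
    rw [Finset.mem_erase, Finset.mem_erase] at hv
    refine mem_of_notMem hZ2 (Finset.mem_union_left _ hv.2.2) ?_
    rw [Finset.mem_insert, Finset.mem_insert]
    rintro (h | h | h)
    · exact hv.1 h
    · exact hv.2.1 h
    · exact hdisj v h hv.2.2
  by_cases hyZ : y ∈ Z <;> by_cases hzZ : z ∈ Z
  · have hZeq : Z = ρ := Finset.Subset.antisymm hZ1 (by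
      intro v hv
      by_cases hvz : v = z
      · exact hvz ▸ hzZ
      by_cases hvy : v = y
      · exact hvy ▸ hyZ
      exact hμZ (Finset.mem_erase.2 ⟨hvy, Finset.mem_erase.2 ⟨hvz, hv⟩⟩))
    rw [hZeq]
    exact mem_Fam_base (Or.inr (Or.inr (Or.inr rfl)))
  · have hZeq : Z = ρ.erase z := by
      apply Finset.Subset.antisymm
      · intro v hv
        rw [Finset.mem_erase]
        exact ⟨fun h => hzZ (h ▸ hv), hZ1 hv⟩
      · intro v hv
        by_cases hvy : v = y
        · exact hvy ▸ hyZ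
        exact hμZ (Finset.mem_erase.2 ⟨hvy, hv⟩)
    rw [hZeq]
    exact mem_Fam_base (Or.inr (Or.inr (Or.inl rfl)))
  · have hZeq : Z = insert z ((ρ.erase z).erase y) := by
      apply Finset.Subset.antisymm
      · intro v hv
        rw [Finset.mem_insert, Finset.mem_erase, Finset.mem_erase]
        by_cases hvz : v = z
        · exact Or.inl hvz
        exact Or.inr ⟨fun h => hyZ (h ▸ hv), hvz, hZ1 hv⟩
      · intro v hv
        rw [Finset.mem_insert] at hv
        rcases hv with rfl | hv
        · exact hzZ
        · exact hμZ hv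
    rw [hZeq]
    exact mem_Fam_4 hy
  · have hZeq : Z = (ρ.erase z).erase y := by
      apply Finset.Subset.antisymm
      · intro v hv
        rw [Finset.mem_erase, Finset.mem_erase]
        exact ⟨fun h => hyZ (h ▸ hv), fun h => hzZ (h ▸ hv), hZ1 hv⟩
      · exact hμZ
    rw [hZeq]
    exact mem_Fam_3 hy

end Fam

end PercRepro.SixFour.S0
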